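import Mathlib.Analysis.SpecialFunctions.Sqrt
import Mathlib.Analysis.SpecialFunctions.Pow.Deriv
import Mathlib.Analysis.Calculus.ContDiff.Operations
import HarnessLib

/-!
# The Cholesky frame of a smooth field of positive-definite `3 × 3` matrices

Analysis/Matrix support file (everything proved). For a symmetric positive-definite real `3 × 3`
matrix `M` the Cholesky factor `L` (`M = L Lᵀ`, `L` lower triangular with positive diagonal) is
given by the classical explicit formulas

  `L₀₀ = √M₀₀`, `L₁₀ = M₁₀/L₀₀`, `L₂₀ = M₂₀/L₀₀`, `L₁₁ = √(M₁₁ − L₁₀²)`,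
  `L₂₁ = (M₂₁ − L₂₀L₁₀)/L₁₁`, `L₂₂ = √(M₂₂ − L₂₀² − L₂₁²)`

(`cholL`), whose radicands are the successive Schur complements and are therefore values of the
quadratic form of `M`, hence positive (`radicand₁_pos`, `radicand₂_pos`, `radicand₃_pos`). The rows
of `Lᵀ` form a **frame** `e_l` with `Σ_l e_lʲ e_lᵏ = M^{jk}` (`sum_cholFrame_mul_cholFrame`), and for
a smooth field `x ↦ Q(x)` of symmetric positive-definite matrices the frame field is smooth
(`contDiff_cholFrame`): the smooth frame normalising the spatial symbol used in the symmetric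
first-order reduction of second-order hyperbolic equations (John 1982, Ch. 5 §3;
`Literature.Analysis.PDE.WaveSystem.Coeffs`).

-- TODO(general form): the recursive block Cholesky factorisation gives the same for `n × n`.

## References

* G. H. Golub, C. F. Van Loan, *Matrix Computations*, 4th ed., Johns Hopkins 2013, §4.2
  (Cholesky factorisation; Thm. 4.2.7). [folklore]
* F. John, *Partial differential equations*, 4th ed., Springer 1982, Ch. 5 §3. [John1982]
-/

noncomputable section

open scoped ContDiff

namespace Literature.Analysis.Matrix

namespace Cholesky3

/-! ### The quadratic form and positive definiteness -/

/-- The quadratic form `ξ ↦ Σ_{jk} M_{jk} ξ_j ξ_k` of a `3 × 3` matrix. [folklore] -/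
def qf (M : Fin 3 → Fin 3 → ℝ) (ξ : Fin 3 → ℝ) : ℝ := ∑ j, ∑ k, M j k * ξ j * ξ k

/-- Expansion of the quadratic form of a symmetric matrix. [folklore] -/
theorem qf_eq (M : Fin 3 → Fin 3 → ℝ) (hsym : ∀ j k, M j k = M k j) (ξ : Fin 3 → ℝ) :
    qf M ξ = M 0 0 * ξ 0 ^ 2 + M 1 1 * ξ 1 ^ 2 + M 2 2 * ξ 2 ^ 2
      + 2 * M 1 0 * ξ 0 * ξ 1 + 2 * M 2 0 * ξ 0 * ξ 2 + 2 * M 2 1 * ξ 1 * ξ 2 := by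
  simp only [qf, Fin.sum_univ_three, hsym 0 1, hsym 0 2, hsym 1 2]
  ring

/-- **Positive definiteness** of a `3 × 3` matrix: the quadratic form is positive off the origin.
[folklore] -/
def IsPosDef (M : Fin 3 → Fin 3 → ℝ) : Prop := ∀ ξ : Fin 3 → ℝ, ξ ≠ 0 → 0 < qf M ξ

/-! ### The Cholesky factor -/

/-- The first radicand `M₀₀`. [folklore] -/
def rad₁ (M : Fin 3 → Fin 3 → ℝ) : ℝ := M 0 0

/-- `L₀₀ = √M₀₀`. [folklore] -/
def l00 (M : Fin 3 → Fin 3 → ℝ) : ℝ := Real.sqrt (rad₁ M)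

/-- `L₁₀ = M₁₀ / L₀₀`. [folklore] -/
def l10 (M : Fin 3 → Fin 3 → ℝ) : ℝ := M 1 0 / l00 M

/-- `L₂₀ = M₂₀ / L₀₀`. [folklore] -/
def l20 (M : Fin 3 → Fin 3 → ℝ) : ℝ := M 2 0 / l00 M

/-- The second radicand `M₁₁ − L₁₀²` (the Schur complement of `M₀₀` in the leading `2 × 2` block).
[folklore] -/
def rad₂ (M : Fin 3 → Fin 3 → ℝ) : ℝ := M 1 1 - M 1 0 ^ 2 / M 0 0

/-- `L₁₁ = √(M₁₁ − L₁₀²)`. [folklore] -/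
def l11 (M : Fin 3 → Fin 3 → ℝ) : ℝ := Real.sqrt (rad₂ M)

/-- `L₂₁ = (M₂₁ − L₂₀ L₁₀) / L₁₁`. [folklore] -/
def l21 (M : Fin 3 → Fin 3 → ℝ) : ℝ := (M 2 1 - M 2 0 * M 1 0 / M 0 0) / l11 M

/-- The third radicand `M₂₂ − L₂₀² − L₂₁²` (the Schur complement of the leading `2 × 2` block).
[folklore] -/
def rad₃ (M : Fin 3 → Fin 3 → ℝ) : ℝ :=
  M 2 2 - M 2 0 ^ 2 / M 0 0 - (M 2 1 - M 2 0 * M 1 0 / M 0 0) ^ 2 / rad₂ M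

/-- `L₂₂ = √(M₂₂ − L₂₀² − L₂₁²)`. [folklore] -/
def l22 (M : Fin 3 → Fin 3 → ℝ) : ℝ := Real.sqrt (rad₃ M)

/-- **The Cholesky factor** `L` (lower triangular, `M = L Lᵀ`). [folklore] -/
def cholL (M : Fin 3 → Fin 3 → ℝ) : Fin 3 → Fin 3 → ℝ :=
  ![![l00 M, 0, 0], ![l10 M, l11 M, 0], ![l20 M, l21 M, l22 M]]

/-- **The Cholesky frame** `e_l = (Lᵀ)_l`, `e_lʲ = L_{jl}`. [cite: John1982, Ch. 5 §3] -/
def cholFrame (M : Fin 3 → Fin 3 → ℝ) (l j : Fin 3) : ℝ := cholL M j l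

/-! ### Positivity of the radicands -/

section PosDef

variable {M : Fin 3 → Fin 3 → ℝ} (hsym : ∀ j k, M j k = M k j) (hpd : IsPosDef M)
include hsym hpd

/-- `M₀₀ > 0`. [folklore] -/
theorem rad₁_pos : 0 < rad₁ M := by
  have h := hpd (Pi.single 0 1) (by simp [funext_iff, Fin.exists_fin_succ])
  rw [qf_eq M hsym] at h
  simpa [rad₁] using h

/-- The leading `2 × 2` minor is positive. [folklore] -/
theorem minor₂_pos : 0 < M 0 0 * M 1 1 - M 1 0 ^ 2 := by
  have h0 := rad₁_pos hsym hpd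
  simp only [rad₁] at h0
  have h := hpd ![-M 1 0, M 0 0, 0] (by
    simp only [ne_eq, funext_iff, Pi.zero_apply, not_forall]
    exact ⟨1, by simp [h0.ne']⟩)
  rw [qf_eq M hsym] at h
  simp only [Matrix.cons_val_zero, Matrix.cons_val_one, Matrix.cons_val] at h
  have : 0 < M 0 0 * (M 0 0 * M 1 1 - M 1 0 ^ 2) := by nlinarith [h]
  exact pos_of_mul_pos_right this h0.le

/-- The second radicand is positive. [folklore] -/
theorem rad₂_pos : 0 < rad₂ M := by
  have h0 := rad₁_pos hsym hpd
  simp only [rad₁] at h0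
  have h2 := minor₂_pos hsym hpd
  have : rad₂ M = (M 0 0 * M 1 1 - M 1 0 ^ 2) / M 0 0 := by
    unfold rad₂; field_simp
  rw [this]
  exact div_pos h2 h0

/-- The third radicand is the value of the quadratic form at `(x*, y*, 1)` with `(x*, y*)` the
minimiser over the first two variables (the Schur complement of the leading block). [folklore] -/
theorem rad₃_eq_qf : rad₃ M = qf M ![-(M 1 1 * M 2 0 - M 1 0 * M 2 1) / (M 0 0 * M 1 1 - M 1 0 ^ 2),
    -(M 0 0 * M 2 1 - M 1 0 * M 2 0) / (M 0 0 * M 1 1 - M 1 0 ^ 2), 1] := by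
  have h0 := rad₁_pos hsym hpd
  simp only [rad₁] at h0
  have h2 := minor₂_pos hsym hpd
  have hr2 : rad₂ M = (M 0 0 * M 1 1 - M 1 0 ^ 2) / M 0 0 := by
    unfold rad₂; field_simp
  rw [qf_eq M hsym]
  simp only [Matrix.cons_val_zero, Matrix.cons_val_one, Matrix.cons_val]
  unfold rad₃
  rw [hr2]
  field_simp
  ring

/-- The third radicand is positive. [folklore] -/
theorem rad₃_pos : 0 < rad₃ M := by
  rw [rad₃_eq_qf hsym hpd]
  refine hpd _ ?_
  simp only [ne_eq, funext_iff, Pi.zero_apply, not_forall]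
  exact ⟨2, by simp⟩

/-! ### `M = L Lᵀ` -/

/-- **The Cholesky identity** in frame form: `Σ_l e_lʲ e_lᵏ = M^{jk}`. [folklore] -/
theorem sum_cholFrame_mul_cholFrame (j k : Fin 3) :
    ∑ l, cholFrame M l j * cholFrame M l k = M j k := by
  have h0 := rad₁_pos hsym hpd
  have h2 := rad₂_pos hsym hpd
  have h3 := rad₃_pos hsym hpd
  have hl00 : l00 M ^ 2 = M 0 0 := Real.sq_sqrt h0.le
  have hl00' : l00 M ≠ 0 := (Real.sqrt_pos.2 h0).ne'
  have hl11 : l11 M ^ 2 = rad₂ M := Real.sq_sqrt h2.le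
  have hl11' : l11 M ≠ 0 := (Real.sqrt_pos.2 h2).ne'
  have hl22 : l22 M ^ 2 = rad₃ M := Real.sq_sqrt h3.le
  have hM00 : M 0 0 ≠ 0 := by simp only [rad₁] at h0; exact h0.ne'
  have hr2 : rad₂ M ≠ 0 := h2.ne'
  -- entries of `L Lᵀ`
  have e00 : l00 M * l00 M = M 0 0 := by nlinarith [hl00]
  have e10 : l10 M * l00 M = M 1 0 := by unfold l10; field_simp
  have e20 : l20 M * l00 M = M 2 0 := by unfold l20; field_simp
  have e11 : l10 M * l10 M + l11 M * l11 M = M 1 1 := by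
    have : l10 M * l10 M = M 1 0 ^ 2 / M 0 0 := by
      unfold l10; rw [div_mul_div_comm, ← sq, ← sq, hl00]
    rw [this, ← sq, hl11]
    unfold rad₂; ring
  have e21 : l20 M * l10 M + l21 M * l11 M = M 2 1 := by
    have : l20 M * l10 M = M 2 0 * M 1 0 / M 0 0 := by
      unfold l20 l10; rw [div_mul_div_comm, ← sq, hl00]
    rw [this]
    unfold l21; field_simp
    ring
  have e22 : l20 M * l20 M + l21 M * l21 M + l22 M * l22 M = M 2 2 := by
    have h20 : l20 M * l20 M = M 2 0 ^ 2 / M 0 0 := by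
      unfold l20; rw [div_mul_div_comm, ← sq, ← sq, hl00]
    have h21 : l21 M * l21 M = (M 2 1 - M 2 0 * M 1 0 / M 0 0) ^ 2 / rad₂ M := by
      unfold l21; rw [div_mul_div_comm, ← sq, ← sq, hl11]
    rw [h20, h21, ← sq, hl22]
    unfold rad₃; ring
  fin_cases j <;> fin_cases k <;>
    simp only [cholFrame, cholL, Fin.sum_univ_three, Fin.zero_eta, Fin.mk_one, Fin.reduceFinMk,
      Matrix.cons_val_zero, Matrix.cons_val_one, Matrix.cons_val, mul_zero, zero_mul, add_zero,
      hsym 0 1, hsym 0 2, hsym 1 2] <;>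
    linarith [e00, e10, e20, e11, e21, e22, mul_comm (l10 M) (l00 M), mul_comm (l20 M) (l00 M),
      mul_comm (l20 M) (l10 M), mul_comm (l21 M) (l11 M)]

end PosDef

/-! ### Smoothness of the Cholesky frame of a smooth positive-definite field -/

section Smooth

variable {X : Type*} [NormedAddCommGroup X] [NormedSpace ℝ X] {Q : X → Fin 3 → Fin 3 → ℝ} {s : Set X}
  (hQ : ∀ j k, ContDiffOn ℝ ∞ (fun x ↦ Q x j k) s) (hsym : ∀ x ∈ s, ∀ j k, Q x j k = Q x k j)
  (hpd : ∀ x ∈ s, IsPosDef (Q x))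
include hQ hsym hpd

/-- `x ↦ L₀₀(Q x)` is smooth. [folklore] -/
theorem contDiffOn_l00 : ContDiffOn ℝ ∞ (fun x ↦ l00 (Q x)) s :=
  (hQ 0 0).sqrt fun x hx ↦ (rad₁_pos (hsym x hx) (hpd x hx)).ne'

/-- `x ↦ L₁₀(Q x)` is smooth. [folklore] -/
theorem contDiffOn_l10 : ContDiffOn ℝ ∞ (fun x ↦ l10 (Q x)) s :=
  (hQ 1 0).div (contDiffOn_l00 hQ hsym hpd) fun x hx ↦
    (Real.sqrt_pos.2 (rad₁_pos (hsym x hx) (hpd x hx))).ne'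

/-- `x ↦ L₂₀(Q x)` is smooth. [folklore] -/
theorem contDiffOn_l20 : ContDiffOn ℝ ∞ (fun x ↦ l20 (Q x)) s :=
  (hQ 2 0).div (contDiffOn_l00 hQ hsym hpd) fun x hx ↦
    (Real.sqrt_pos.2 (rad₁_pos (hsym x hx) (hpd x hx))).ne'

/-- `x ↦ rad₂(Q x)` is smooth. [folklore] -/
theorem contDiffOn_rad₂ : ContDiffOn ℝ ∞ (fun x ↦ rad₂ (Q x)) s :=
  (hQ 1 1).sub (((hQ 1 0).pow 2).div (hQ 0 0) fun x hx ↦ (rad₁_pos (hsym x hx) (hpd x hx)).ne')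

/-- `x ↦ L₁₁(Q x)` is smooth. [folklore] -/
theorem contDiffOn_l11 : ContDiffOn ℝ ∞ (fun x ↦ l11 (Q x)) s :=
  (contDiffOn_rad₂ hQ hsym hpd).sqrt fun x hx ↦ (rad₂_pos (hsym x hx) (hpd x hx)).ne'

/-- `x ↦ L₂₁(Q x)` is smooth. [folklore] -/
theorem contDiffOn_l21 : ContDiffOn ℝ ∞ (fun x ↦ l21 (Q x)) s :=
  ((hQ 2 1).sub (((hQ 2 0).mul (hQ 1 0)).div (hQ 0 0) fun x hx ↦
    (rad₁_pos (hsym x hx) (hpd x hx)).ne')).div (contDiffOn_l11 hQ hsym hpd) fun x hx ↦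
    (Real.sqrt_pos.2 (rad₂_pos (hsym x hx) (hpd x hx))).ne'

/-- `x ↦ rad₃(Q x)` is smooth. [folklore] -/
theorem contDiffOn_rad₃ : ContDiffOn ℝ ∞ (fun x ↦ rad₃ (Q x)) s :=
  ((hQ 2 2).sub (((hQ 2 0).pow 2).div (hQ 0 0) fun x hx ↦ (rad₁_pos (hsym x hx) (hpd x hx)).ne')).sub
    ((((hQ 2 1).sub (((hQ 2 0).mul (hQ 1 0)).div (hQ 0 0) fun x hx ↦
      (rad₁_pos (hsym x hx) (hpd x hx)).ne')).pow 2).div (contDiffOn_rad₂ hQ hsym hpd) fun x hx ↦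
      (rad₂_pos (hsym x hx) (hpd x hx)).ne')

/-- `x ↦ L₂₂(Q x)` is smooth. [folklore] -/
theorem contDiffOn_l22 : ContDiffOn ℝ ∞ (fun x ↦ l22 (Q x)) s :=
  (contDiffOn_rad₃ hQ hsym hpd).sqrt fun x hx ↦ (rad₃_pos (hsym x hx) (hpd x hx)).ne'

/-- **The Cholesky frame of a smooth field of symmetric positive-definite matrices is smooth.**
[folklore] -/
theorem contDiffOn_cholFrame (l j : Fin 3) : ContDiffOn ℝ ∞ (fun x ↦ cholFrame (Q x) l j) s := by
  fin_cases l <;> fin_cases j <;>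
    simp only [cholFrame, cholL, Fin.zero_eta, Fin.mk_one, Fin.reduceFinMk, Matrix.cons_val_zero,
      Matrix.cons_val_one, Matrix.cons_val] <;>
    first
    | exact contDiffOn_const
    | exact contDiffOn_l00 hQ hsym hpd
    | exact contDiffOn_l10 hQ hsym hpd
    | exact contDiffOn_l20 hQ hsym hpd
    | exact contDiffOn_l11 hQ hsym hpd
    | exact contDiffOn_l21 hQ hsym hpd
    | exact contDiffOn_l22 hQ hsym hpd

end Smooth

/-- **Smooth Cholesky frame, global version.** [folklore] -/
theorem contDiff_cholFrame {X : Type*} [NormedAddCommGroup X] [NormedSpace ℝ X]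
    {Q : X → Fin 3 → Fin 3 → ℝ} (hQ : ∀ j k, ContDiff ℝ ∞ (fun x ↦ Q x j k))
    (hsym : ∀ x j k, Q x j k = Q x k j) (hpd : ∀ x, IsPosDef (Q x)) (l j : Fin 3) :
    ContDiff ℝ ∞ (fun x ↦ cholFrame (Q x) l j) :=
  contDiffOn_univ.1 (contDiffOn_cholFrame (fun j k ↦ (hQ j k).contDiffOn) (fun x _ ↦ hsym x)
    (fun x _ ↦ hpd x) l j)

end Cholesky3

end Literature.Analysis.Matrix

end
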